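import Summits.QuantumFields.BalabanUV.Beta.FP.ConstrainedBiLaplacianResponseTwoLevelRate
import Summits.QuantumFields.BalabanUV.Beta.GAN24.SubAveragingUnitTower
import Mathlib.Analysis.SpecificLimits.Basic

/-!
# `BalabanUV.Beta.FP.ConstrainedBiLaplacianResponseTowerLimit` — road «FP» for binder row D1, DESIGN ROW **GHOST-STEP** brick (g3) «(CONV-C)-Hb»,
# THE CONVERGENCE HALF, FILE 6e — THE CELL-INTEGRATED BLOCK-SUM RESPONSE CONVERGES THROUGH ALL REFINEMENTS: for every scale `n₀ ≥ 1`, every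
# level-`n₀` cell `τ₀` of a block `X` and every source block `y`, the cell sums `k ↦ Σ_{τ′ ⊂ τ₀} Hb_{n₀k}((n₀k)•X + τ′, y)` converge as `k → ∞`
# (through ALL integers, every refinement tower `k = L^j` giving the same limit), with the explicit rate
# `|Σ_{τ′ ⊂ τ₀} Hb_{n₀k}(…) − lim| ≤ 2·Cb(d+1,2)·(48(d+1))^{d+1}∕k · e^{−kappaB (d+1) 2·|X − y|_∞}∕n₀`.

NOT IN PRINT; OUR PROOF ATTEMPT (binder row G-an2-4 ∕ (CONV-C), prover part P3 = fibre∕strip «Woodbury» lineage, gen 28; CRUX TEAM (2),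
2026-08-21).  HONEST DEPENDENCY (cell records, verbatim): «continuum YM on T⁴ ⇐ BetaPertH ∧ nine spine estimates (0/9 proved); BetaPertH ⇐ (D1) ∧
(D4) ∧ CAP+tail; G-an2-4 gates asym, D1 and NE2/3/4.»  HONEST FRAMING (cell contract, verbatim): «discharging `BetaPertH` makes Bałaban's UV
stability UNCONDITIONAL — a real constructive-QFT result; it is NOT the continuum limit and NOT the Clay problem.»  ABSOLUTE RULE (cell charter,
verbatim): «No internally-minted statement may enter as a cited fact. Every hypothesis is either kernel-proved in this package or a verbatim quotation
of a PUBLISHED theorem with page reference. The manuscript(s) under audit are NOT citable for their own disputed steps — they are the thing under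
adjudication; programme-internal (2001/route/tribunal) claims are never citable.»  THIS MODULE is [folklore] bookkeeping over FILE 6d's one-step law
`ConstrainedBiLaplacianResponseTwoLevelRate.Hb_two_level_rate`, the lineage's `SubAveragingUnitTower.Tsub_bijective` and Mathlib's geometric-series
Cauchy criterion (pattern of the lineage's `SubAveragingContinuumLimit` §1, here with one-step bounds `C_L∕k` instead of `C_L∕k²`); it cites nothing as a
hypothesis, has bookkeeping `def`s (`towerLim`, `cellNat`, `HcellT`, `HbCellLim`, `cellIdx`), no `def … : Prop` hypothesis, no `sorry`.

## Contents (dimension `d+1`; order `2`)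

* §1 [folklore] abstract: `‖F(k·L) − F k‖ ≤ C_L∕k·w` for all `k, L ≥ 1` ⇒ `F n → towerLim F` through all `n` with `|F n − towerLim F| ≤ 2·C₂∕n·w`, and
  `F (L^j) → towerLim F` for every `L ≥ 2` (`exists_tendsto_mul_two_pow_inv`, `tendsto_mul_two_pow_towerLim`, `abs_sub_towerLim_le`, `tendsto_towerLim`,
  `tendsto_pow_towerLim`).
* §2 [folklore] `(1 + log x)^D ≤ D^D·x` (`one_add_log_pow_le`) and the LINEAR MAJORANT of the lineage's harmonic factor `HF n (d+1) ≤ (48(d+1))^{d+1}·n`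
  (`HF_le_linear`).
* §3 the cell sums `HcellT n₀ τ₀ X y N := Σ_{τ′ : cellNat n₀ N τ′ = τ₀} Hb_N(finePt N X τ′, y)` (total in `N`, junk `0` at `N = 0`), the cell test under refinement
  (`cellNat_Tsub`), **`HcellT_step`** (FILE 6d summed over the cell: `|HcellT (n₀kL) − HcellT (n₀k)| ≤ Cb·HF(n₀k)∕(n₀k)²·e^{−κ|X−y|}`), `HcellT_step_inv`,
  and the limit theorems **`abs_HcellT_sub_HbCellLim_le`**, **`tendsto_HcellT`**, `tendsto_HcellT_pow` for `HbCellLim n₀ τ₀ X y := towerLim (k ↦ HcellT (n₀k))`.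
* §4 `sum_HcellT` (the cell sums add up to FILE 4b's unit block sum `[X = y]` at every level) and **`sum_HbCellLim`** (`Σ_{τ₀} HbCellLim n₀ τ₀ X y = [X = y]`:
  unit block sum is preserved in the limit).

NOT HERE (honest): the same for the compressed inverse `Sb` with both legs cell-averaged; identification of `HbCellLim` with a continuum bi-Laplacian
block-spin response (no continuum object is defined in this tree).  0∕4 row-D1 binders touched.  NOT (CONV-C), NEVER «G-an2-4 closed», NOT the ghost
step law, NOT SDF, NOT D1, NOT BetaPertH, NOT continuum, NOT Clay.  Provenance: prover-b2b-balaban-gan24-p3-g28-0 (unit `b2b-balaban-gan24-p3`, gen 28),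
2026-08-21; no existing file touched.
-/

noncomputable section

namespace Summit.QuantumFields.BalabanUV.Beta.FP.ConstrainedBiLaplacianResponseTowerLimit

open Filter Topology Finset
open Literature.MathematicalPhysics.QuantumFieldTheory.Balaban1983to89.B4ContourShift (supNorm)
open Literature.MathematicalPhysics.QuantumFieldTheory.Balaban1983to89.B4Green244 (finePt)
open Summit.QuantumFields.BalabanUV.Beta.FP.ConstrainedBiLaplacianStrip (kappaB)
open Summit.QuantumFields.BalabanUV.Beta.FP.ConstrainedBiLaplacianResponseTwoLevelEstimate (Cb Cb_nonneg)
open Summit.QuantumFields.BalabanUV.Beta.FP.ConstrainedBiLaplacianResponseJunction (Hb_eq_re_KH sum_finePt_KH)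
open Summit.QuantumFields.BalabanUV.Beta.FP.ConstrainedBiLaplacianResponseTwoLevelRate (Hb_two_level_rate)
open Summit.QuantumFields.BalabanUV.Beta.GAN24.SubAveragingKernel (Tsub HF HF_nonneg HF_le_log)
open Summit.QuantumFields.BalabanUV.Beta.GAN24.SubAveragingUnitTower (Tsub_bijective)
open Summit.QuantumFields.BalabanUV.Beta.FP.BiLaplaceBlockResponse (Hb)
open scoped Real

/-! ## §1 One-step bounds `C_L∕k` force convergence of the full sequence (abstract, real sequences) -/

section Abstract

variable {F : ℕ → ℝ} {C : ℕ → ℝ} {w : ℝ}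

/-- [folklore] THE TOWER LIMIT of a real sequence: `lim_{m → ∞} F (2^m)` (a junk value if the limit does not exist). -/
def towerLim (F : ℕ → ℝ) : ℝ := limUnder atTop (fun m : ℕ => F (2 ^ m))

/-- [folklore] ALONG THE DYADIC TOWER ABOVE `n`: if `|F(k·L) − F(k)| ≤ C_L∕k·w` for all `k, L ≥ 1`, then `m ↦ F (n·2^m)` converges and its limit `ℓ`
satisfies `|F n − ℓ| ≤ 2·(C₂∕n·w)` (geometric series with ratio `1∕2`). -/
theorem exists_tendsto_mul_two_pow_inv
    (h : ∀ k L : ℕ, 1 ≤ k → 1 ≤ L → |F (k * L) - F k| ≤ C L / (k : ℝ) * w) {n : ℕ} (hn : 1 ≤ n) :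
    ∃ ℓ : ℝ, Tendsto (fun m : ℕ => F (n * 2 ^ m)) atTop (𝓝 ℓ) ∧ |F n - ℓ| ≤ 2 * (C 2 / (n : ℝ) * w) := by
  set G : ℕ → ℝ := fun m => F (n * 2 ^ m) with hG
  have hstep : ∀ m : ℕ, dist (G m) (G (m + 1)) ≤ C 2 / (n : ℝ) * w * (1 / 2) ^ m := by
    intro m
    have hnm : 1 ≤ n * 2 ^ m := Nat.one_le_iff_ne_zero.mpr (mul_ne_zero (by omega) (pow_ne_zero m two_ne_zero))
    have hb := h (n * 2 ^ m) 2 hnm (by norm_num)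
    have eG : G (m + 1) = F (n * 2 ^ m * 2) := by
      show F (n * 2 ^ (m + 1)) = F (n * 2 ^ m * 2)
      rw [pow_succ, mul_assoc]
    have hn0 : (n : ℝ) ≠ 0 := by exact_mod_cast (show n ≠ 0 by omega)
    calc dist (G m) (G (m + 1)) = |F (n * 2 ^ m * 2) - F (n * 2 ^ m)| := by rw [dist_comm, Real.dist_eq, eG]
      _ ≤ C 2 / ((n * 2 ^ m : ℕ) : ℝ) * w := hb
      _ = C 2 / (n : ℝ) * w * (1 / 2) ^ m := by push_cast; rw [one_div, inv_pow]; field_simp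
  have hCauchy : CauchySeq G := cauchySeq_of_le_geometric (1 / 2 : ℝ) (C 2 / (n : ℝ) * w) (by norm_num) hstep
  obtain ⟨ℓ, hℓ⟩ := cauchySeq_tendsto_of_complete hCauchy
  refine ⟨ℓ, hℓ, ?_⟩
  have hd := dist_le_of_le_geometric_of_tendsto₀ (1 / 2 : ℝ) (C 2 / (n : ℝ) * w) (by norm_num) hstep hℓ
  have e0 : G 0 = F n := by simp [hG]
  rw [e0, Real.dist_eq] at hd
  calc |F n - ℓ| ≤ C 2 / (n : ℝ) * w / (1 - 1 / 2) := hd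
    _ = 2 * (C 2 / (n : ℝ) * w) := by ring

/-- [folklore] **ALL DYADIC TOWERS HAVE THE SAME LIMIT**: `F (n·2^m) → towerLim F` for every `n ≥ 1`. -/
theorem tendsto_mul_two_pow_towerLim
    (h : ∀ k L : ℕ, 1 ≤ k → 1 ≤ L → |F (k * L) - F k| ≤ C L / (k : ℝ) * w) {n : ℕ} (hn : 1 ≤ n) :
    Tendsto (fun m : ℕ => F (n * 2 ^ m)) atTop (𝓝 (towerLim F)) := by
  obtain ⟨ℓ₁, h₁, -⟩ := exists_tendsto_mul_two_pow_inv h (le_refl 1)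
  have h₁' : Tendsto (fun m : ℕ => F (2 ^ m)) atTop (𝓝 ℓ₁) := by simpa only [one_mul] using h₁
  have hlim : towerLim F = ℓ₁ := by unfold towerLim; exact h₁'.limUnder_eq
  have hdiff : Tendsto (fun m : ℕ => F (n * 2 ^ m) - F (2 ^ m)) atTop (𝓝 0) := by
    have hg : Tendsto (fun m : ℕ => C n * w * (1 / 2 : ℝ) ^ m) atTop (𝓝 0) := by
      have hq := (tendsto_pow_atTop_nhds_zero_of_lt_one (by norm_num : (0 : ℝ) ≤ 1 / 2)
        (by norm_num : (1 : ℝ) / 2 < 1)).const_mul (C n * w)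
      simpa only [mul_zero] using hq
    refine squeeze_zero_norm (fun m => ?_) hg
    have h2m : 1 ≤ 2 ^ m := Nat.one_le_two_pow
    have hb := h (2 ^ m) n h2m hn
    rw [mul_comm (2 ^ m) n] at hb
    rw [Real.norm_eq_abs]
    calc |F (n * 2 ^ m) - F (2 ^ m)| ≤ C n / ((2 ^ m : ℕ) : ℝ) * w := hb
      _ = C n * w * (1 / 2) ^ m := by push_cast; rw [one_div, inv_pow]; field_simp
  have hsum : Tendsto (fun m : ℕ => F (n * 2 ^ m)) atTop (𝓝 (ℓ₁ + 0)) :=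
    (h₁'.add hdiff).congr fun m => by ring
  rw [add_zero] at hsum
  rwa [hlim]

/-- [folklore] **THE RATE TO THE ONE LIMIT**: `|F n − towerLim F| ≤ 2·C₂∕n·w` for EVERY `n ≥ 1`. -/
theorem abs_sub_towerLim_le
    (h : ∀ k L : ℕ, 1 ≤ k → 1 ≤ L → |F (k * L) - F k| ≤ C L / (k : ℝ) * w) {n : ℕ} (hn : 1 ≤ n) :
    |F n - towerLim F| ≤ 2 * (C 2 / (n : ℝ) * w) := by
  obtain ⟨ℓ, hℓ, hb⟩ := exists_tendsto_mul_two_pow_inv h hn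
  rw [tendsto_nhds_unique (tendsto_mul_two_pow_towerLim h hn) hℓ]
  exact hb

/-- [folklore] **THE FULL SEQUENCE CONVERGES**: `F n → towerLim F` as `n → ∞` through all integers. -/
theorem tendsto_towerLim
    (h : ∀ k L : ℕ, 1 ≤ k → 1 ≤ L → |F (k * L) - F k| ≤ C L / (k : ℝ) * w) :
    Tendsto F atTop (𝓝 (towerLim F)) := by
  rw [tendsto_iff_norm_sub_tendsto_zero]
  have h1 : Tendsto (fun n : ℕ => ((n : ℝ))⁻¹) atTop (𝓝 0) := tendsto_inv_atTop_zero.comp tendsto_natCast_atTop_atTop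
  have hK : Tendsto (fun n : ℕ => 2 * (C 2 / (n : ℝ) * w)) atTop (𝓝 0) := by
    have e : (fun n : ℕ => 2 * (C 2 / (n : ℝ) * w)) = fun n : ℕ => (2 * C 2 * w) * ((n : ℝ))⁻¹ := by
      funext n; ring
    rw [e]
    simpa only [mul_zero] using h1.const_mul (2 * C 2 * w)
  refine squeeze_zero' (Eventually.of_forall fun n => norm_nonneg _) ?_ hK
  filter_upwards [eventually_ge_atTop 1] with n hn
  rw [Real.norm_eq_abs]
  exact abs_sub_towerLim_le h hn

/-- [folklore] **REFINEMENT INDEPENDENCE**: for every refinement factor `L ≥ 2` the tower `j ↦ F (L^j)` tends to the SAME limit `towerLim F`. -/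
theorem tendsto_pow_towerLim
    (h : ∀ k L : ℕ, 1 ≤ k → 1 ≤ L → |F (k * L) - F k| ≤ C L / (k : ℝ) * w) {L : ℕ} (hL : 2 ≤ L) :
    Tendsto (fun j : ℕ => F (L ^ j)) atTop (𝓝 (towerLim F)) :=
  (tendsto_towerLim h).comp (tendsto_pow_atTop_atTop_of_one_lt (by omega : 1 < L))

end Abstract

/-! ## §2 The linear majorant of the harmonic factor -/

/-- [folklore] `(1 + log x)^D ≤ D^D·x` for `x ≥ 1`, `D ≥ 1` (from `1 + t∕D ≤ e^{t∕D}`). -/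
theorem one_add_log_pow_le (D : ℕ) (hD : 1 ≤ D) {x : ℝ} (hx : 1 ≤ x) : (1 + Real.log x) ^ D ≤ (D : ℝ) ^ D * x := by
  have hD' : (1 : ℝ) ≤ D := by exact_mod_cast hD
  have hDpos : (0 : ℝ) < D := by linarith
  have ht : 0 ≤ Real.log x := Real.log_nonneg hx
  have h1 : 1 + Real.log x ≤ D * Real.exp (Real.log x / D) := by
    have he : Real.log x / D + 1 ≤ Real.exp (Real.log x / D) := Real.add_one_le_exp _
    have : 1 + Real.log x ≤ D * (Real.log x / D + 1) := by
      rw [mul_add, mul_div_cancel₀ _ hDpos.ne', mul_one]; linarith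
    exact this.trans (mul_le_mul_of_nonneg_left he hDpos.le)
  have h2 : (1 + Real.log x) ^ D ≤ (D * Real.exp (Real.log x / D)) ^ D := pow_le_pow_left₀ (by linarith) h1 D
  refine h2.trans (le_of_eq ?_)
  rw [mul_pow, ← Real.exp_nat_mul, mul_div_cancel₀ _ hDpos.ne', Real.exp_log (by linarith)]

variable {d : ℕ}

/-- [folklore] **THE LINEAR MAJORANT OF THE HARMONIC FACTOR**: `HF n (d+1) ≤ (48(d+1))^{d+1}·n` for `n ≥ 1`. -/
theorem HF_le_linear (n : ℕ) (hn : 1 ≤ n) : HF n (d + 1) ≤ (48 * ((d : ℝ) + 1)) ^ (d + 1) * n := by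
  have hn' : (1 : ℝ) ≤ n := by exact_mod_cast hn
  have h := one_add_log_pow_le (d + 1) (by omega) hn'
  push_cast at h
  calc HF n (d + 1) ≤ (48 * (1 + Real.log n)) ^ (d + 1) := HF_le_log n (d + 1)
    _ = 48 ^ (d + 1) * (1 + Real.log n) ^ (d + 1) := mul_pow _ _ _
    _ ≤ 48 ^ (d + 1) * (((d : ℝ) + 1) ^ (d + 1) * n) := mul_le_mul_of_nonneg_left h (by positivity)
    _ = (48 * ((d : ℝ) + 1)) ^ (d + 1) * n := by rw [mul_pow]; ring

/-! ## §3 The cell sums of the block-sum response and their limit -/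

/-- [folklore] THE CELL TEST VECTOR of a level-`N` fine point `T` of a block read at scale `n₀` (`N = n₀·k`: `i ↦ ⌊T_i∕k⌋`); `T` lies in the
level-`n₀` cell `τ₀` iff `cellNat n₀ N T = τ₀` (as `ℕ`-vectors). -/
def cellNat (n₀ N : ℕ) (T : Fin (d + 1) → Fin N) : Fin (d + 1) → ℕ := fun i => (T i : ℕ) * n₀ / N

/-- [our object] THE CELL SUM OF THE BLOCK-SUM RESPONSE at level `N`: `Σ_{T : cellNat n₀ N T = τ₀} Hb_N(finePt N X T, y)` (total in `N`; junk `0` at `N = 0`). -/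
def HcellT (n₀ : ℕ) (τ₀ : Fin (d + 1) → Fin n₀) (X y : Fin (d + 1) → ℤ) (N : ℕ) : ℝ :=
  if hN : N = 0 then 0 else
    haveI : NeZero N := ⟨hN⟩
    ∑ T : Fin (d + 1) → Fin N, if cellNat n₀ N T = (fun i => (τ₀ i : ℕ)) then Hb (N := N) (finePt N X T) y else 0

/-- [folklore] The cell sum at a level `N ≥ 1`, unfolded. -/
theorem HcellT_eq (n₀ : ℕ) (τ₀ : Fin (d + 1) → Fin n₀) (X y : Fin (d + 1) → ℤ) (N : ℕ) [NeZero N] :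
    HcellT n₀ τ₀ X y N = ∑ T : Fin (d + 1) → Fin N, if cellNat n₀ N T = (fun i => (τ₀ i : ℕ)) then Hb (N := N) (finePt N X T) y else 0 := by
  unfold HcellT
  rw [dif_neg (NeZero.ne N)]

/-- [folklore] THE CELL TEST IS STABLE UNDER REFINEMENT: the children `Tsub τ′ ρ` of a level-`n₀k` point `τ′` have the cell test vector of `τ′`. -/
theorem cellNat_Tsub (n₀ : ℕ) [NeZero n₀] (k L : ℕ) (hL : 0 < L) (τ' : Fin (d + 1) → Fin (n₀ * k)) (ρ : Fin (d + 1) → Fin L) :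
    cellNat n₀ (n₀ * k * L) (Tsub (n₀ * k) L τ' ρ) = cellNat n₀ (n₀ * k) τ' := by
  have hn₀ : 0 < n₀ := Nat.pos_of_ne_zero (NeZero.ne n₀)
  funext i
  show (L * (τ' i : ℕ) + (ρ i : ℕ)) * n₀ / (n₀ * k * L) = (τ' i : ℕ) * n₀ / (n₀ * k)
  have h1 : (L * (τ' i : ℕ) + (ρ i : ℕ)) * n₀ / (n₀ * k * L) = (τ' i : ℕ) / k := by
    rw [mul_comm (L * (τ' i : ℕ) + (ρ i : ℕ)) n₀, show n₀ * k * L = n₀ * (L * k) by ring, Nat.mul_div_mul_left _ _ hn₀,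
      ← Nat.div_div_eq_div_mul, Nat.mul_add_div hL, Nat.div_eq_of_lt (ρ i).isLt, add_zero]
  have h2 : (τ' i : ℕ) * n₀ / (n₀ * k) = (τ' i : ℕ) / k := by
    rw [mul_comm (τ' i : ℕ) n₀, Nat.mul_div_mul_left _ _ hn₀]
  rw [h1, h2]

/-- [our proof] **THE ONE-STEP LAW SUMMED OVER A CELL**: for every `k, L ≥ 1`,
`|HcellT (n₀kL) − HcellT (n₀k)| ≤ Cb (d+1) L·HF (n₀k) (d+1)∕(n₀k)²·e^{−kappaB (d+1) 2·|X − y|_∞}`. -/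
theorem HcellT_step (n₀ : ℕ) [NeZero n₀] (τ₀ : Fin (d + 1) → Fin n₀) (X y : Fin (d + 1) → ℤ) (k L : ℕ) (hk : 1 ≤ k) (hL : 1 ≤ L) :
    |HcellT n₀ τ₀ X y (n₀ * k * L) - HcellT n₀ τ₀ X y (n₀ * k)|
      ≤ Cb (d + 1) L * HF (n₀ * k) (d + 1) / ((n₀ * k : ℕ) : ℝ) ^ 2 * Real.exp (-(kappaB (d + 1) 2 * supNorm (X - y))) := by
  have hn₀ : n₀ ≠ 0 := NeZero.ne n₀
  haveI : NeZero k := ⟨by omega⟩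
  haveI : NeZero L := ⟨by omega⟩
  haveI : NeZero (n₀ * k) := ⟨mul_ne_zero hn₀ (by omega)⟩
  haveI : NeZero (n₀ * k * L) := ⟨mul_ne_zero (mul_ne_zero hn₀ (by omega)) (by omega)⟩
  have hN : (0 : ℝ) < ((n₀ * k : ℕ) : ℝ) := by exact_mod_cast Nat.pos_of_ne_zero (NeZero.ne (n₀ * k))
  have hCb := Cb_nonneg (d + 1) L
  have hHF := HF_nonneg (n₀ * k) (d + 1)
  set E : ℝ := Real.exp (-(kappaB (d + 1) 2 * supNorm (X - y))) with hE
  have hEpos : 0 < E := Real.exp_pos _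
  set b : ℝ := (((n₀ * k : ℕ) : ℝ) ^ (d + 1))⁻¹ * (Cb (d + 1) L * HF (n₀ * k) (d + 1) / ((n₀ * k : ℕ) : ℝ) ^ 2) * E with hb
  have hb0 : 0 ≤ b :=
    mul_nonneg (mul_nonneg (inv_nonneg.mpr (pow_nonneg hN.le _)) (div_nonneg (mul_nonneg hCb hHF) (pow_nonneg hN.le 2))) hEpos.le
  rw [HcellT_eq, HcellT_eq]
  -- re-index the finer level through `(τ′, ρ) ↦ Tsub τ′ ρ`
  have hre : ∑ T : Fin (d + 1) → Fin (n₀ * k * L), (if cellNat n₀ (n₀ * k * L) T = (fun i => (τ₀ i : ℕ)) then Hb (N := n₀ * k * L) (finePt (n₀ * k * L) X T) y else 0)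
      = ∑ τ' : Fin (d + 1) → Fin (n₀ * k), ∑ ρ : Fin (d + 1) → Fin L,
          (if cellNat n₀ (n₀ * k) τ' = (fun i => (τ₀ i : ℕ)) then Hb (N := n₀ * k * L) (finePt (n₀ * k * L) X (Tsub (n₀ * k) L τ' ρ)) y else 0) := by
    rw [← (Tsub_bijective (d := d + 1) (n₀ * k) L).sum_comp
      (fun T => if cellNat n₀ (n₀ * k * L) T = (fun i => (τ₀ i : ℕ)) then Hb (N := n₀ * k * L) (finePt (n₀ * k * L) X T) y else 0), Fintype.sum_prod_type]
    refine Finset.sum_congr rfl fun τ' _ => Finset.sum_congr rfl fun ρ _ => ?_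
    simp only [cellNat_Tsub n₀ k L (by omega) τ' ρ]
  rw [hre, ← Finset.sum_sub_distrib]
  have hpt : ∀ τ' : Fin (d + 1) → Fin (n₀ * k),
      |(∑ ρ : Fin (d + 1) → Fin L, (if cellNat n₀ (n₀ * k) τ' = (fun i => (τ₀ i : ℕ)) then Hb (N := n₀ * k * L) (finePt (n₀ * k * L) X (Tsub (n₀ * k) L τ' ρ)) y else 0))
        - (if cellNat n₀ (n₀ * k) τ' = (fun i => (τ₀ i : ℕ)) then Hb (N := n₀ * k) (finePt (n₀ * k) X τ') y else 0)| ≤ b := by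
    intro τ'
    by_cases hc : cellNat n₀ (n₀ * k) τ' = (fun i => (τ₀ i : ℕ))
    · simp only [hc, if_true]
      rw [hb, hE]
      exact Hb_two_level_rate (n₀ * k) L X y τ'
    · simp only [hc, if_false, Finset.sum_const_zero, sub_zero, abs_zero]
      exact hb0
  have hcard : (Finset.univ : Finset (Fin (d + 1) → Fin (n₀ * k))).card = (n₀ * k) ^ (d + 1) := by
    simp only [Finset.card_univ, Fintype.card_pi, Finset.prod_const, Fintype.card_fin]
  have hpow : (((n₀ * k) ^ (d + 1) : ℕ) : ℝ) = (((n₀ * k : ℕ) : ℝ)) ^ (d + 1) := by push_cast; ring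
  calc |∑ τ' : Fin (d + 1) → Fin (n₀ * k), ((∑ ρ : Fin (d + 1) → Fin L,
          (if cellNat n₀ (n₀ * k) τ' = (fun i => (τ₀ i : ℕ)) then Hb (N := n₀ * k * L) (finePt (n₀ * k * L) X (Tsub (n₀ * k) L τ' ρ)) y else 0))
          - (if cellNat n₀ (n₀ * k) τ' = (fun i => (τ₀ i : ℕ)) then Hb (N := n₀ * k) (finePt (n₀ * k) X τ') y else 0))|
      ≤ ∑ τ' : Fin (d + 1) → Fin (n₀ * k), |(∑ ρ : Fin (d + 1) → Fin L,
          (if cellNat n₀ (n₀ * k) τ' = (fun i => (τ₀ i : ℕ)) then Hb (N := n₀ * k * L) (finePt (n₀ * k * L) X (Tsub (n₀ * k) L τ' ρ)) y else 0))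
          - (if cellNat n₀ (n₀ * k) τ' = (fun i => (τ₀ i : ℕ)) then Hb (N := n₀ * k) (finePt (n₀ * k) X τ') y else 0)| := Finset.abs_sum_le_sum_abs _ _
    _ ≤ ∑ _τ' : Fin (d + 1) → Fin (n₀ * k), b := Finset.sum_le_sum fun τ' _ => hpt τ'
    _ = (((n₀ * k : ℕ) : ℝ)) ^ (d + 1) * b := by rw [Finset.sum_const, hcard, nsmul_eq_mul, hpow]
    _ = Cb (d + 1) L * HF (n₀ * k) (d + 1) / ((n₀ * k : ℕ) : ℝ) ^ 2 * E := by
        rw [hb, ← mul_assoc, ← mul_assoc, mul_inv_cancel₀ (pow_ne_zero _ hN.ne'), one_mul]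

/-- [our proof] **THE ONE-STEP LAW IN THE SHAPE `C_L∕k`** (through `HF_le_linear`): for every `k, L ≥ 1`,
`|HcellT (n₀kL) − HcellT (n₀k)| ≤ Cb (d+1) L·(48(d+1))^{d+1}∕k · (e^{−kappaB (d+1) 2·|X − y|_∞}∕n₀)`. -/
theorem HcellT_step_inv (n₀ : ℕ) [NeZero n₀] (τ₀ : Fin (d + 1) → Fin n₀) (X y : Fin (d + 1) → ℤ) (k L : ℕ) (hk : 1 ≤ k) (hL : 1 ≤ L) :
    |HcellT n₀ τ₀ X y (n₀ * k * L) - HcellT n₀ τ₀ X y (n₀ * k)|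
      ≤ Cb (d + 1) L * (48 * ((d : ℝ) + 1)) ^ (d + 1) / (k : ℝ) * (Real.exp (-(kappaB (d + 1) 2 * supNorm (X - y))) / n₀) := by
  have hn₀ : 0 < n₀ := Nat.pos_of_ne_zero (NeZero.ne n₀)
  have hnk : 1 ≤ n₀ * k := Nat.one_le_iff_ne_zero.mpr (mul_ne_zero (by omega) (by omega))
  have hn₀' : (n₀ : ℝ) ≠ 0 := by exact_mod_cast hn₀.ne'
  have hk' : (k : ℝ) ≠ 0 := by exact_mod_cast (show k ≠ 0 by omega)
  have hCb := Cb_nonneg (d + 1) L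
  have hHF := HF_le_linear (d := d) (n₀ * k) hnk
  refine (HcellT_step n₀ τ₀ X y k L hk hL).trans ?_
  calc Cb (d + 1) L * HF (n₀ * k) (d + 1) / ((n₀ * k : ℕ) : ℝ) ^ 2 * Real.exp (-(kappaB (d + 1) 2 * supNorm (X - y)))
      ≤ Cb (d + 1) L * ((48 * ((d : ℝ) + 1)) ^ (d + 1) * ((n₀ * k : ℕ) : ℝ)) / ((n₀ * k : ℕ) : ℝ) ^ 2
          * Real.exp (-(kappaB (d + 1) 2 * supNorm (X - y))) := by gcongr
    _ = Cb (d + 1) L * (48 * ((d : ℝ) + 1)) ^ (d + 1) / (k : ℝ) * (Real.exp (-(kappaB (d + 1) 2 * supNorm (X - y))) / n₀) := by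
        push_cast; field_simp

/-- [our object] THE LIMIT OF THE CELL SUMS (the tower limit of `k ↦ HcellT (n₀k)`). -/
def HbCellLim (n₀ : ℕ) (τ₀ : Fin (d + 1) → Fin n₀) (X y : Fin (d + 1) → ℤ) : ℝ := towerLim fun k => HcellT n₀ τ₀ X y (n₀ * k)

/-- [folklore] The one-step hypothesis of §1 for the sequence `k ↦ HcellT (n₀k)`. -/
theorem HcellT_hyp (n₀ : ℕ) [NeZero n₀] (τ₀ : Fin (d + 1) → Fin n₀) (X y : Fin (d + 1) → ℤ) :
    ∀ k L : ℕ, 1 ≤ k → 1 ≤ L → |HcellT n₀ τ₀ X y (n₀ * (k * L)) - HcellT n₀ τ₀ X y (n₀ * k)|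
      ≤ (Cb (d + 1) L * (48 * ((d : ℝ) + 1)) ^ (d + 1)) / (k : ℝ) * (Real.exp (-(kappaB (d + 1) 2 * supNorm (X - y))) / n₀) := by
  intro k L hk hL
  rw [← mul_assoc]
  exact HcellT_step_inv n₀ τ₀ X y k L hk hL

/-- [our proof] **THE CELL-INTEGRATED BLOCK-SUM RESPONSE CONVERGES WITH RATE `1∕k`**: for every scale `n₀ ≥ 1`, cell `τ₀`, blocks `X, y` and every `k ≥ 1`,
`|HcellT (n₀k) − HbCellLim| ≤ 2·(Cb (d+1) 2·(48(d+1))^{d+1}∕k · e^{−kappaB (d+1) 2·|X − y|_∞}∕n₀)`. -/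
theorem abs_HcellT_sub_HbCellLim_le (n₀ : ℕ) [NeZero n₀] (τ₀ : Fin (d + 1) → Fin n₀) (X y : Fin (d + 1) → ℤ) (k : ℕ) (hk : 1 ≤ k) :
    |HcellT n₀ τ₀ X y (n₀ * k) - HbCellLim n₀ τ₀ X y|
      ≤ 2 * ((Cb (d + 1) 2 * (48 * ((d : ℝ) + 1)) ^ (d + 1)) / (k : ℝ) * (Real.exp (-(kappaB (d + 1) 2 * supNorm (X - y))) / n₀)) :=
  abs_sub_towerLim_le (F := fun k => HcellT n₀ τ₀ X y (n₀ * k))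
    (C := fun L => Cb (d + 1) L * (48 * ((d : ℝ) + 1)) ^ (d + 1)) (HcellT_hyp n₀ τ₀ X y) hk

/-- [our proof] **CONVERGENCE THROUGH ALL REFINEMENTS**: `HcellT (n₀k) → HbCellLim` as `k → ∞` through all integers. -/
theorem tendsto_HcellT (n₀ : ℕ) [NeZero n₀] (τ₀ : Fin (d + 1) → Fin n₀) (X y : Fin (d + 1) → ℤ) :
    Tendsto (fun k : ℕ => HcellT n₀ τ₀ X y (n₀ * k)) atTop (𝓝 (HbCellLim n₀ τ₀ X y)) :=
  tendsto_towerLim (F := fun k => HcellT n₀ τ₀ X y (n₀ * k))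
    (C := fun L => Cb (d + 1) L * (48 * ((d : ℝ) + 1)) ^ (d + 1)) (HcellT_hyp n₀ τ₀ X y)

/-- [our proof] **REFINEMENT INDEPENDENCE**: along every refinement tower `k = L^j`, `L ≥ 2`, the cell sums tend to the same `HbCellLim`. -/
theorem tendsto_HcellT_pow (n₀ : ℕ) [NeZero n₀] (τ₀ : Fin (d + 1) → Fin n₀) (X y : Fin (d + 1) → ℤ) {L : ℕ} (hL : 2 ≤ L) :
    Tendsto (fun j : ℕ => HcellT n₀ τ₀ X y (n₀ * L ^ j)) atTop (𝓝 (HbCellLim n₀ τ₀ X y)) :=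
  tendsto_pow_towerLim (F := fun k => HcellT n₀ τ₀ X y (n₀ * k))
    (C := fun L => Cb (d + 1) L * (48 * ((d : ℝ) + 1)) ^ (d + 1)) (HcellT_hyp n₀ τ₀ X y) hL

/-! ## §4 Unit block sum is preserved in the limit -/

/-- [folklore] THE CELL INDEX of a level-`n₀k` fine point (`⌊T_i∕k⌋`). -/
def cellIdx (n₀ k : ℕ) (T : Fin (d + 1) → Fin (n₀ * k)) : Fin (d + 1) → Fin n₀ := fun i =>
  ⟨(T i : ℕ) * n₀ / (n₀ * k), by
    have hT := (T i).isLt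
    have hk : 0 < k := Nat.pos_of_ne_zero fun h => by subst h; simp at hT
    have hn₀ : 0 < n₀ := Nat.pos_of_ne_zero fun h => by subst h; simp at hT
    rw [mul_comm (T i : ℕ) n₀, Nat.mul_div_mul_left _ _ hn₀, Nat.div_lt_iff_lt_mul hk]
    exact hT⟩

/-- [folklore] The cell test singles out the cell index. -/
theorem cellNat_eq_iff (n₀ k : ℕ) (τ₀ : Fin (d + 1) → Fin n₀) (T : Fin (d + 1) → Fin (n₀ * k)) :
    cellNat n₀ (n₀ * k) T = (fun i => (τ₀ i : ℕ)) ↔ τ₀ = cellIdx n₀ k T := by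
  constructor
  · intro h; funext i; apply Fin.ext; exact (congrFun h i).symm
  · intro h; subst h; funext i; rfl

/-- [folklore] **THE CELL SUMS ADD UP TO THE UNIT BLOCK SUM** at every level: `Σ_{τ₀} HcellT n₀ τ₀ X y (n₀k) = [X = y]` (FILE 4b's `sum_finePt_KH`). -/
theorem sum_HcellT (n₀ : ℕ) [NeZero n₀] (X y : Fin (d + 1) → ℤ) (k : ℕ) (hk : 1 ≤ k) :
    ∑ τ₀ : Fin (d + 1) → Fin n₀, HcellT n₀ τ₀ X y (n₀ * k) = if X = y then 1 else 0 := by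
  haveI : NeZero (n₀ * k) := ⟨mul_ne_zero (NeZero.ne n₀) (by omega)⟩
  simp_rw [HcellT_eq]
  rw [Finset.sum_comm]
  have h1 : ∀ T : Fin (d + 1) → Fin (n₀ * k),
      ∑ τ₀ : Fin (d + 1) → Fin n₀, (if cellNat n₀ (n₀ * k) T = (fun i => (τ₀ i : ℕ)) then Hb (N := n₀ * k) (finePt (n₀ * k) X T) y else 0)
        = Hb (N := n₀ * k) (finePt (n₀ * k) X T) y := by
    intro T
    simp_rw [cellNat_eq_iff]
    rw [Finset.sum_ite_eq' Finset.univ (cellIdx n₀ k T), if_pos (Finset.mem_univ _)]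
  simp_rw [h1, Hb_eq_re_KH]
  rw [← Complex.re_sum, sum_finePt_KH]
  split_ifs <;> simp

/-- [our proof] **UNIT BLOCK SUM IS PRESERVED IN THE LIMIT**: `Σ_{τ₀} HbCellLim n₀ τ₀ X y = [X = y]` for every scale `n₀ ≥ 1`. -/
theorem sum_HbCellLim (n₀ : ℕ) [NeZero n₀] (X y : Fin (d + 1) → ℤ) :
    ∑ τ₀ : Fin (d + 1) → Fin n₀, HbCellLim n₀ τ₀ X y = if X = y then 1 else 0 := by
  have h : Tendsto (fun k : ℕ => ∑ τ₀ : Fin (d + 1) → Fin n₀, HcellT n₀ τ₀ X y (n₀ * k)) atTop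
      (𝓝 (∑ τ₀ : Fin (d + 1) → Fin n₀, HbCellLim n₀ τ₀ X y)) :=
    tendsto_finsetSum _ fun τ₀ _ => tendsto_HcellT n₀ τ₀ X y
  have h' : Tendsto (fun k : ℕ => ∑ τ₀ : Fin (d + 1) → Fin n₀, HcellT n₀ τ₀ X y (n₀ * k)) atTop (𝓝 (if X = y then 1 else 0)) := by
    refine (tendsto_const_nhds (x := (if X = y then (1 : ℝ) else 0))).congr' ?_
    filter_upwards [eventually_ge_atTop 1] with k hk
    exact (sum_HcellT n₀ X y k hk).symm
  exact tendsto_nhds_unique h h'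

end Summit.QuantumFields.BalabanUV.Beta.FP.ConstrainedBiLaplacianResponseTowerLimit

end
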